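import Literature.Computability.Complexity.CircuitSizeProofs
import HarnessLib

/-!
# `EXP ⊄ P/poly` gives a language in `EXP` of superpolynomial circuit complexity infinitely often
# (the hard function of Babai–Fortnow–Nisan–Wigderson's i.o. generator; IW98, Case 1)

Literature / circuit complexity, first step of hypothesis `h₁` (Case 1 of Impagliazzo–Wigderson 1998,
`EXP ⊄ P/poly`, = Babai–Fortnow–Nisan–Wigderson 1993) of `impagliazzoWigderson1998_of_generators`
(`UniformDerandomizationAssembly.lean`): the NW/IKW generator of the tree
(`IKW2002_thm11_tableGenerator`, `IKWGeneratorsProofs.lean`) is pseudorandom when armed with the truth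
table of a function of circuit complexity above a polynomial threshold; under `EXP ⊄ P/poly` some
`L ∈ EXP` supplies such tables at INFINITELY MANY lengths, above EVERY polynomial:

* `frequently_lt_circuitSize_of_not_mem_PPoly` — `L ∉ P/poly ⟹ ∀ C, ∃ᶠ n, n^C < L.circuitSize n`
  (from `P/poly = ⋃ₚ SIZE(p)` and `mem_SIZE_iff_circuitSize_le_holds`; the finitely many small lengths
  are absorbed by raising the polynomial by a constant);
* `exists_frequently_hard_of_not_EXP_subset_PPoly` — `¬ EXP ⊆ P/poly ⟹ ∃ L ∈ EXP, ∀ C, ∃ᶠ n,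
  n^C < L.circuitSize n`.

Everything is proved; no definitions.

## References

* L. Babai, L. Fortnow, N. Nisan, A. Wigderson, *BPP has subexponential time simulations unless
  EXPTIME has publishable proofs*, Comput. Complexity 3 (1993) 307–318, §3–4 (the hard function of
  the low-end generator; cited through [ImpagliazzoWigderson2001], §2.1).
* [AroraBarakCC2009] CUP 2009, Def. 6.5 (`P/poly = ⋃_c SIZE(n^c)`), Thm. 20.7 (3) and the i.o. remark.
-/

noncomputable section

namespace Literature.Computability.Complexity

open Filter Polynomial

/-- **Outside `P/poly`, the circuit complexity beats every polynomial infinitely often**: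
`L ∉ P/poly ⟹ ∀ C, ∃ᶠ n, n^C < L.circuitSize n`. (If `L.circuitSize n ≤ n^C` for all `n ≥ N`, then
`L.circuitSize n ≤ n^C + K` for all `n` with `K` the maximum below `N`, i.e. `L ∈ SIZE(n^C + K) ⊆ P/poly`.)
[cite: AroraBarakCC2009, Def. 6.5] -/
theorem frequently_lt_circuitSize_of_not_mem_PPoly {L : Language Bool} (hL : L ∉ PPoly) (C : ℕ) :
    ∃ᶠ n : ℕ in atTop, n ^ C < L.circuitSize n := by
  by_contra hnot
  rw [not_frequently] at hnot
  obtain ⟨N, hN⟩ := eventually_atTop.1 hnot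
  apply hL
  -- the bound `n^C + K` everywhere
  set K : ℕ := (Finset.range N).sup fun n => L.circuitSize n with hK
  have hbound : ∀ n, L.circuitSize n ≤ n ^ C + K := by
    intro n
    rcases lt_or_ge n N with hn | hn
    · have : L.circuitSize n ≤ K := Finset.le_sup (f := fun n => L.circuitSize n) (Finset.mem_range.2 hn)
      omega
    · have := not_lt.1 (hN n hn)
      omega
  have hmem : L ∈ SIZE fun n => n ^ C + K := (mem_SIZE_iff_circuitSize_le_holds L _).2 hbound
  exact Set.mem_iUnion.2 ⟨X ^ C + Polynomial.C K, SIZE_mono (fun n => by simp) hmem⟩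

/-- **`EXP ⊄ P/poly` gives a language of `EXP` hard above every polynomial infinitely often** — the
truth tables arming the i.o. generator of Case 1. [cite: AroraBarakCC2009, Thm. 20.7 and §20.1 (i.o.)] -/
theorem exists_frequently_hard_of_not_EXP_subset_PPoly (h : ¬ EXP ⊆ PPoly) :
    ∃ L ∈ EXP, ∀ C : ℕ, ∃ᶠ n : ℕ in atTop, n ^ C < L.circuitSize n := by
  obtain ⟨L, hL, hLP⟩ := Set.not_subset.1 h
  exact ⟨L, hL, frequently_lt_circuitSize_of_not_mem_PPoly hLP⟩

end Literature.Computability.Complexity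

end
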